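import Mathlib
import Summits.CriticalPhenomena.PercolationContinuityZ3.Theses.PercNearOneGluing

/-!
# Line `afree-cluster-pioneers` — skeleton for crux `NoHeavyLowerTail` (stmt-CriticalPhenomena-4575)

Route `route-CriticalPhenomena-PercNearOneGluing`; crux decl
`Summit.CriticalPhenomena.PercolationContinuityZ3.Theses.PercNearOneGluing.NoHeavyLowerTail`
(≡ Kozma–Nitzan Conjecture 3, Disproof §B `iff_nearOneGluing`).

Idea (card `Ideas/afree-cluster-pioneers.md`, v2; triage r1: pass ×3): cut the graph at the `A`-free open
cluster `C*` of the observer `o`.  The PIONEERS `D ⊆ A` (relay points reached from `o` by an open path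
whose interior avoids `A`) are independent coins given `C*`; `{D = ∅} = {o ↮ A}`; for `a ∈ D` the relay
block of `o` IS the relay block of `a`.  Hence:

* `pointBudget` (PROVED here, Markov) — per-point budget: pairwise `δ`-reliability of `A` (hypothesis
  H2 of the crux, load-bearing by Disproof §C.1 `noHeavyLowerTail_false_without_pairwise`) gives
  `P(|blk a| < t) ≤ 2δ` for `2t ≤ |A|`.  This is the ONLY place H2 enters the line.
* `stub_spreadSwitch` — the engine: for pairwise disjoint events `Q_i` under `prodBernoulli` whose
  pairwise MEETS (`ω ∩ ω'`) land in a zone `Z`, `∑ P(Q_i) ≤ max_i P(Q_i) + 2 √P(Z)`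
  (Ahlswede–Daykin four functions theorem for the log-modular product measure + a greedy split).
* `stub_oneFinger_of_spreadSwitch` — pockets entered through ≤ 1 pioneer cost one point budget plus
  `2 √P(o ↮ A)`: the reduction of the one-finger event to the spread switch of the increasing events
  `{a ∈ D}` (`1 ≤ N ⇒ D ≠ ∅`; `blk o = blk a` for a pioneer `a`; `{D = ∅} = {o ↮ A}`).
* `stub_fewFingers`   — pockets entered through `2 ≤ |D| ≤ d` pioneers cost `C_d (η + P(o ↮ A))^{κ_d}`
  (popularity threshold + four functions; on paper for `d = 2`, induction in `d` with `κ_d = 2^{-d}`).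
* `stub_manyFingers`  — the TRANSFER / residual crux MFB: for some `d₀`, pockets entered through MORE than
  `d₀` pioneers cost `C (η + P(o ↮ A))^κ` — many conditionally independent entrances into one set
  that the relay world `G − C*` seals as a whole.

`NoHeavyLowerTail_of` composes them (real proof, kernel-checked): given `ε`, pick `δ` by continuity
at `0` of `δ ↦ 2δ + 2√δ + C₁(3δ)^κ₁ + C₂(3δ)^κ₂`; with `t := δ·EN/ε ≤ |A|/4` the budgets are `η = 2δ`
(`pointBudget`, uses H2); if `o ∈ A` the bad event is inside `o`'s own budget; if `o ∉ A` split the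
bad event by `|D| ≤ 1`, `2 ≤ |D| ≤ d₀`, `d₀ < |D|` and add the three bounds.  The resulting rate
`δ(ε)` is polynomially small in `ε`, consistent with Disproof §D.3 `not_noHeavyLowerTailRate`
(no rate better than linear).

All stub signatures are self-contained formulas over existing declarations
(`prodBernoulli`, `openConn`, `openConnIn`); the pioneer set is written inline as
`A.filter fun a => ω ∈ openConnIn ((↑A)ᶜ ∪ {o, a}) o a`.
-/

namespace Summit.CriticalPhenomena.PercolationContinuityZ3.Cruxes.NoHeavyLowerTail.AfreeClusterPioneers

open scoped BigOperators Classical Topology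
open MeasureTheory Filter Literature.Probability.LatticeModels Literature.Probability.Percolation

/-! ## A proved lemma of the line: the per-point budget (where H2 is consumed) -/

/-- Every event of the finite configuration space `Set (Sym2 (Fin n))` is measurable. -/
theorem measurableSet_bondConfig {n : ℕ} (s : Set (BondConfig (Fin n))) : MeasurableSet s :=
  s.to_countable.measurableSet

/-- **pointBudget** (proved; Markov).  If every relay point `a' ∈ A` is joined to `a ∈ A` with
probability `≥ 1 - δ`, then for thresholds `t` with `2t ≤ |A|` the relay block of `a`,
`blk a = C(a) ∩ A`, has fewer than `t` points with probability at most `2δ`: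
`E|A \ blk a| = ∑_{a'} P(a ↮ a') ≤ δ|A|` and `{|blk a| < t} ⊆ {|A \ blk a| ≥ |A|/2}`.
This is where hypothesis H2 (pairwise reliability) of the crux is consumed
(Disproof §C.1 `noHeavyLowerTail_false_without_pairwise`: any proof must use H2). -/
theorem pointBudget
    (n : ℕ) (w : Sym2 (Fin n) → unitInterval) (A : Finset (Fin n)) (a : Fin n) (δ t : ℝ)
    (ha : a ∈ A)
    (hrel : ∀ a' ∈ A, 1 - δ ≤ (prodBernoulli w).real (openConn a a'))
    (h2t : 2 * t ≤ (A.card : ℝ)) :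
    (prodBernoulli w).real {ω | ((A.filter fun a' => ω ∈ openConn a a').card : ℝ) < t} ≤ 2 * δ := by
  set μ := prodBernoulli w with hμ
  have hmeas : ∀ s : Set (BondConfig (Fin n)), MeasurableSet s := measurableSet_bondConfig
  have hApos : (0 : ℝ) < A.card := by exact_mod_cast Finset.card_pos.mpr ⟨a, ha⟩
  -- the number of failed connections from `a`, as a sum of indicators
  set f : BondConfig (Fin n) → ℝ := fun ω => ((A.filter fun a' => ω ∉ openConn a a').card : ℝ)
    with hf
  have hf_eq : f = fun ω => ∑ a' ∈ A, (openConn a a')ᶜ.indicator (fun _ => (1 : ℝ)) ω := by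
    funext ω
    simp only [hf, Set.indicator_apply, Set.mem_compl_iff, Finset.sum_boole]
  have hint_i : ∀ a' ∈ A, Integrable ((openConn a a')ᶜ.indicator fun _ => (1 : ℝ)) μ :=
    fun a' _ => (integrable_const (1 : ℝ)).indicator (hmeas _)
  have hfint : Integrable f μ := by
    rw [hf_eq]; exact integrable_finsetSum A hint_i
  have hf_nonneg : 0 ≤ᵐ[μ] f := Filter.Eventually.of_forall fun ω => by positivity
  have hintegral : ∫ ω, f ω ∂μ = ∑ a' ∈ A, μ.real (openConn a a')ᶜ := by
    rw [hf_eq, integral_finsetSum A hint_i]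
    refine Finset.sum_congr rfl fun a' _ => ?_
    rw [integral_indicator_const (1 : ℝ) (hmeas _), smul_eq_mul, mul_one]
  have hsum_le : ∑ a' ∈ A, μ.real (openConn a a')ᶜ ≤ A.card * δ := by
    calc ∑ a' ∈ A, μ.real (openConn a a')ᶜ ≤ ∑ a' ∈ A, δ :=
          Finset.sum_le_sum fun a' ha' => by
            rw [probReal_compl_eq_one_sub (hmeas _)]; linarith [hrel a' ha']
      _ = A.card * δ := by simp
  -- Markov at level |A|/2
  have hmarkov := mul_meas_ge_le_integral_of_nonneg hf_nonneg hfint ((A.card : ℝ) / 2)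
  have hsub : {ω | ((A.filter fun a' => ω ∈ openConn a a').card : ℝ) < t} ⊆
      {ω | (A.card : ℝ) / 2 ≤ f ω} := by
    intro ω hω
    have hcard : ((A.filter fun a' => ω ∈ openConn a a').card : ℝ) + f ω = A.card := by
      simp only [hf]
      exact_mod_cast Finset.card_filter_add_card_filter_not (s := A) (fun a' => ω ∈ openConn a a')
    simp only [Set.mem_setOf_eq] at hω ⊢
    linarith
  calc μ.real {ω | ((A.filter fun a' => ω ∈ openConn a a').card : ℝ) < t}
      ≤ μ.real {ω | (A.card : ℝ) / 2 ≤ f ω} := measureReal_mono hsub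
    _ ≤ 2 * δ := by
        have h1 : (A.card : ℝ) / 2 * μ.real {ω | (A.card : ℝ) / 2 ≤ f ω} ≤ A.card * δ :=
          hmarkov.trans (hintegral ▸ hsum_le)
        have h2 : (A.card : ℝ) * (μ.real {ω | (A.card : ℝ) / 2 ≤ f ω} - 2 * δ) ≤ 0 := by
          nlinarith
        nlinarith [h2, hApos, (measureReal_nonneg : 0 ≤ μ.real {ω | (A.card : ℝ) / 2 ≤ f ω})]

/-! ## Stubs (registered; `sorry` only here) -/

/-- **stub_spreadSwitch** (the engine; size M; card `meet-closure-four-functions` Z2 in zone form,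
constant `2` as sharpened by triage r1-1/r1-2).  Let `Q₀, …, Q_{L-1}` be pairwise disjoint events of
bond configurations on `Fin n` such that the MEET `ω ∩ ω'` (intersection of the open-edge sets) of any
two configurations taken from two different `Q_i` lies in the zone `Z`.  Then under any product measure
`prodBernoulli w`: `∑_i P(Q_i) ≤ m + 2 √P(Z)` whenever every `P(Q_i) ≤ m` (`0 ≤ m`).
Proof: for an index split `I ⊔ Iᶜ`, Ahlswede–Daykin (Mathlib `four_functions_theorem_univ` on the
distributive lattice `Set (Sym2 (Fin n))`, with `f₁ = 1_{⋃_I Q}·μ`, `f₂ = 1_{⋃_{Iᶜ} Q}·μ`,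
`f₃ = 1_Z·μ`, `f₄ = μ`, `μ{ω}μ{ω'} = μ{ω ∩ ω'}μ{ω ∪ ω'}` for the product point masses) gives
`P(⋃_I Q)·P(⋃_{Iᶜ} Q) ≤ P(Z)`; a greedy split makes both factors `≥ (∑ - max)/2`. -/
theorem stub_spreadSwitch :
    ∀ (n L : ℕ) (w : Sym2 (Fin n) → unitInterval) (Q : Fin L → Set (BondConfig (Fin n)))
      (Z : Set (BondConfig (Fin n))) (m : ℝ),
      0 ≤ m →
      (∀ i j, i ≠ j → Disjoint (Q i) (Q j)) →
      (∀ i j, i ≠ j → ∀ ω ∈ Q i, ∀ ω' ∈ Q j, ω ∩ ω' ∈ Z) →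
      (∀ i, (prodBernoulli w).real (Q i) ≤ m) →
      ∑ i, (prodBernoulli w).real (Q i) ≤ m + 2 * Real.sqrt ((prodBernoulli w).real Z) := by
  sorry

/-- **stub_oneFinger_of_spreadSwitch** (one finger is harmless, reduced to the engine; size M; card P2).
Assuming the spread-switch inequality: for `o ∉ A` and budgets `P(|blk a| < t) ≤ η` (`a ∈ A`), the event
"`o`'s relay block is non-empty, has fewer than `t` points, and `o` has AT MOST ONE pioneer" has
probability `≤ η + 2 √P(o ↮ A)`.  Percolation content: (i) `1 ≤ N` forces a pioneer (the first
`A`-vertex on an open `o → A` path), so on the event `D = {a}`; (ii) a pioneer `a` lies in `C(o)`, so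
`blk o = blk a` and `N < t` is `|blk a| < t` — the part through the likeliest single pioneer `a*` costs
`≤ η`; (iii) the parts `Q_a = {D = {a}}` are pairwise disjoint, `D` is monotone in `ω` (each `{a ∈ D}` =
`openConnIn (Aᶜ ∪ {o,a}) o a` is increasing), so meets of `Q_a, Q_b` (`a ≠ b`) lie in `Z = {D = ∅}`,
and `{D = ∅} ⊆ {o ↮ A}`; the spread switch bounds `∑_{a ≠ a*} P(D = {a}) ≤ 2 √P(o ↮ A)`. -/
theorem stub_oneFinger_of_spreadSwitch :
    (∀ (n L : ℕ) (w : Sym2 (Fin n) → unitInterval) (Q : Fin L → Set (BondConfig (Fin n)))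
      (Z : Set (BondConfig (Fin n))) (m : ℝ),
      0 ≤ m →
      (∀ i j, i ≠ j → Disjoint (Q i) (Q j)) →
      (∀ i j, i ≠ j → ∀ ω ∈ Q i, ∀ ω' ∈ Q j, ω ∩ ω' ∈ Z) →
      (∀ i, (prodBernoulli w).real (Q i) ≤ m) →
      ∑ i, (prodBernoulli w).real (Q i) ≤ m + 2 * Real.sqrt ((prodBernoulli w).real Z)) →
    ∀ (n : ℕ) (w : Sym2 (Fin n) → unitInterval) (A : Finset (Fin n)) (o : Fin n) (t η : ℝ),
      o ∉ A → 0 ≤ η →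
      (∀ a ∈ A, (prodBernoulli w).real
          {ω | ((A.filter fun a' => ω ∈ openConn a a').card : ℝ) < t} ≤ η) →
      (prodBernoulli w).real
          {ω | 1 ≤ (A.filter fun a => ω ∈ openConn o a).card ∧
               ((A.filter fun a => ω ∈ openConn o a).card : ℝ) < t ∧
               (A.filter fun a => ω ∈ openConnIn ((↑A : Set (Fin n))ᶜ ∪ {o, a}) o a).card ≤ 1} ≤
        η + 2 * Real.sqrt ((prodBernoulli w).real (⋃ a ∈ A, openConn o a)ᶜ) := by
  sorry

/-- **stub_fewFingers** (few fingers are harmless; size L; card P3).  For every `d` there are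
`C, κ > 0` such that for `o ∉ A` and budgets `η`: the event "`o`'s relay block is non-empty, has fewer
than `t` points, and `o` has between `2` and `d` pioneers" has probability `≤ C (η + P(o ↮ A))^κ`.
Proof for `d = 2` (`κ = 1/4`): call `a` popular if `P(a ∈ D, |D| ≤ 2) ≥ θ` (at most `2/θ` such points,
as `E|D| 1{|D| ≤ 2} ≤ 2`); pairs through a popular `a` are charged to its budget (`blk o = blk a`, total
`≤ (2/θ)η`); the parts `{D = {a,b}}` over pairs of unpopular points are disjoint with pairwise meets in
the zone `{D = ∅} ∪ ⋃_{x unpopular} {D = {x}}`, of mass `≤ P(o↮A) + θ + 2√P(o↮A)` (spread switch), so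
the zone form of `stub_spreadSwitch` bounds their total by `θ + 2√(P(o↮A) + θ + 2√P(o↮A))`; take
`θ := √η`.  General `d`: the same induction on the level `k ≤ d` (zone = lower unpopular levels),
`κ_d = 2^{-d}`; written out in FindingsIdeator3.md R6 / the line card. -/
theorem stub_fewFingers :
    ∀ d : ℕ, ∃ C κ : ℝ, 0 < C ∧ 0 < κ ∧
      ∀ (n : ℕ) (w : Sym2 (Fin n) → unitInterval) (A : Finset (Fin n)) (o : Fin n) (t η : ℝ),
        o ∉ A → 0 ≤ η →
        (∀ a ∈ A, (prodBernoulli w).real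
            {ω | ((A.filter fun a' => ω ∈ openConn a a').card : ℝ) < t} ≤ η) →
        (prodBernoulli w).real
            {ω | 1 ≤ (A.filter fun a => ω ∈ openConn o a).card ∧
                 ((A.filter fun a => ω ∈ openConn o a).card : ℝ) < t ∧
                 2 ≤ (A.filter fun a => ω ∈ openConnIn ((↑A : Set (Fin n))ᶜ ∪ {o, a}) o a).card ∧
                 (A.filter fun a => ω ∈ openConnIn ((↑A : Set (Fin n))ᶜ ∪ {o, a}) o a).card ≤ d} ≤
          C * (η + (prodBernoulli w).real (⋃ a ∈ A, openConn o a)ᶜ) ^ κ := by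
  sorry

/-- **stub_manyFingers** (MANY-FINGER BOUND — the Transfer MFB of the card, i.e. the residual crux of
the line; size XL; HARDEST).  There are `d₀` and `C, κ > 0` such that for `o ∉ A`, thresholds
`2t ≤ |A|`, budgets `η` and pairwise `η`-reliability of `A`: the event "`o`'s relay block is non-empty,
has fewer than `t` points, and `o` has MORE than `d₀` pioneers" has probability `≤ C (η + P(o ↮ A))^κ`.
Structure available only on this event (card P4): given the `A`-free cluster `C*` of `o`, the `> d₀`
pioneers are INDEPENDENT Bernoulli(`c_a(C*)`) entrances, all of which must lead into ONE set that the
relay world `G − C*` seals as a whole — (a) many fingers into a small zone force the contact intensity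
outside the zone to be tiny (a wall already paid for in `P(C*)`); (b) the per-point Harris budget
`E[|D|; bad] ≤ 2δ E|D|` vs the first-pioneer decomposition differ exactly by 'no OTHER pioneer' vs
'no EARLIER pioneer' — a disjoint-occurrence (BK/Reimer) statement about `d₀` independent entrances.
The card's bolder, finitely-testable form drops the reliability premise (budget-normalised MFB);
refuters sweep that one on the antechamber / private-door / nested families. -/
theorem stub_manyFingers :
    ∃ d₀ : ℕ, ∃ C κ : ℝ, 0 < C ∧ 0 < κ ∧
      ∀ (n : ℕ) (w : Sym2 (Fin n) → unitInterval) (A : Finset (Fin n)) (o : Fin n) (t η : ℝ),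
        o ∉ A → 0 ≤ η →
        (∀ a ∈ A, ∀ a' ∈ A, 1 - η ≤ (prodBernoulli w).real (openConn a a')) →
        (∀ a ∈ A, (prodBernoulli w).real
            {ω | ((A.filter fun a' => ω ∈ openConn a a').card : ℝ) < t} ≤ η) →
        2 * t ≤ (A.card : ℝ) →
        (prodBernoulli w).real
            {ω | 1 ≤ (A.filter fun a => ω ∈ openConn o a).card ∧
                 ((A.filter fun a => ω ∈ openConn o a).card : ℝ) < t ∧
                 d₀ < (A.filter fun a => ω ∈ openConnIn ((↑A : Set (Fin n))ᶜ ∪ {o, a}) o a).card} ≤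
          C * (η + (prodBernoulli w).real (⋃ a ∈ A, openConn o a)ᶜ) ^ κ := by
  sorry

/-! ## Composition (real proof, no `sorry`): the stubs imply the crux BY NAME -/

/-- Choice of `δ`: the error budget `2δ + 2√δ + C₁(3δ)^κ₁ + C₂(3δ)^κ₂` is continuous at `0` with
value `0`, so it is `< ε` for some `0 < δ < ε/4`. -/
theorem exists_delta (ε C₁ κ₁ C₂ κ₂ : ℝ) (hε : 0 < ε) (hκ₁ : 0 < κ₁) (hκ₂ : 0 < κ₂) :
    ∃ δ : ℝ, 0 < δ ∧ δ < ε / 4 ∧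
      2 * δ + 2 * Real.sqrt δ + C₁ * (3 * δ) ^ κ₁ + C₂ * (3 * δ) ^ κ₂ < ε := by
  set f : ℝ → ℝ := fun x => 2 * x + 2 * Real.sqrt x + C₁ * (3 * x) ^ κ₁ + C₂ * (3 * x) ^ κ₂ with hf
  have h3 : Continuous fun x : ℝ => 3 * x := continuous_const.mul continuous_id
  have hcont : Continuous f := by
    refine ((((continuous_const.mul continuous_id).add
      (continuous_const.mul Real.continuous_sqrt)).add
      (continuous_const.mul ((Real.continuous_rpow_const hκ₁.le).comp h3))).add
      (continuous_const.mul ((Real.continuous_rpow_const hκ₂.le).comp h3)))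
  have hf0 : f 0 < ε := by
    simp [hf, Real.zero_rpow hκ₁.ne', Real.zero_rpow hκ₂.ne', hε]
  have hev : ∀ᶠ x in 𝓝 (0 : ℝ), f x < ε :=
    hcont.continuousAt.eventually_lt continuousAt_const hf0
  have hev' : ∀ᶠ x in 𝓝 (0 : ℝ), x < ε / 4 := eventually_lt_nhds (by positivity)
  have hw : ∀ᶠ x in 𝓝[>] (0 : ℝ), (f x < ε ∧ x < ε / 4) ∧ 0 < x :=
    ((hev.and hev').filter_mono nhdsWithin_le_nhds).and self_mem_nhdsWithin
  obtain ⟨δ, ⟨h1, h2⟩, h3⟩ := hw.exists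
  exact ⟨δ, h3, h2, h1⟩

/-- **The composition.**  `pointBudget` (proved) and the stubs `stub_spreadSwitch`,
`stub_oneFinger_of_spreadSwitch`, `stub_fewFingers`, `stub_manyFingers` imply the crux
`PercNearOneGluing.NoHeavyLowerTail`, concluded BY NAME. -/
theorem NoHeavyLowerTail_of :
    Summit.CriticalPhenomena.PercolationContinuityZ3.Theses.PercNearOneGluing.NoHeavyLowerTail := by
  intro ε hε
  obtain ⟨d₀, C₂, κ₂, hC₂, hκ₂, hMF⟩ := stub_manyFingers
  obtain ⟨C₁, κ₁, hC₁, hκ₁, hFF⟩ := stub_fewFingers d₀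
  obtain ⟨δ, hδ, hδ4, hsum⟩ := exists_delta ε C₁ κ₁ C₂ κ₂ hε hκ₁ hκ₂
  refine ⟨δ, hδ, ?_⟩
  intro n w A o hH1 hH2
  -- notation
  set μ := prodBernoulli w with hμ
  set S : ℝ := ∑ a ∈ A, μ.real (openConn o a) with hS
  set t : ℝ := δ * S / ε with ht
  -- the mean is at most |A|, so the threshold is at most |A|/4
  have hS0 : 0 ≤ S := Finset.sum_nonneg fun a _ => measureReal_nonneg
  have hSA : S ≤ (A.card : ℝ) := by
    calc S ≤ ∑ a ∈ A, (1 : ℝ) := Finset.sum_le_sum fun a _ => measureReal_le_one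
      _ = (A.card : ℝ) := by simp
  have htS : t ≤ S / 4 := by
    have h1 : δ * S ≤ ε / 4 * S := mul_le_mul_of_nonneg_right hδ4.le hS0
    calc t = δ * S / ε := rfl
      _ ≤ ε / 4 * S / ε := div_le_div_of_nonneg_right h1 hε.le
      _ = S / 4 := by field_simp
  have h2t : 2 * t ≤ (A.card : ℝ) := by linarith [Nat.cast_nonneg (α := ℝ) A.card]
  -- per-point budgets η = 2δ (pointBudget; consumes H2)
  have hbud : ∀ a ∈ A,
      μ.real {ω | ((A.filter fun a' => ω ∈ openConn a a').card : ℝ) < t} ≤ 2 * δ :=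
    fun a ha => pointBudget n w A a δ t ha (fun a' ha' => (hH2 a ha a' ha').le) h2t
  by_cases ho : o ∈ A
  · -- o is itself a relay point: the bad event lies inside o's own budget
    calc μ.real {ω | 1 ≤ (A.filter fun a => ω ∈ openConn o a).card ∧
              ((A.filter fun a => ω ∈ openConn o a).card : ℝ) < t}
        ≤ μ.real {ω | ((A.filter fun a' => ω ∈ openConn o a').card : ℝ) < t} :=
          measureReal_mono (fun ω hω => hω.2)
      _ ≤ 2 * δ := hbud o ho
      _ < ε := by
          have := Real.sqrt_nonneg δ
          have h1 : 0 ≤ C₁ * (3 * δ) ^ κ₁ := mul_nonneg hC₁.le (Real.rpow_nonneg (by linarith) _)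
          have h2 : 0 ≤ C₂ * (3 * δ) ^ κ₂ := mul_nonneg hC₂.le (Real.rpow_nonneg (by linarith) _)
          linarith
  · -- o ∉ A: split by the number of pioneers
    have hδA : μ.real (⋃ a ∈ A, openConn o a)ᶜ < δ := by
      rw [probReal_compl_eq_one_sub (measurableSet_bondConfig _)]
      linarith
    have hδA0 : 0 ≤ μ.real (⋃ a ∈ A, openConn o a)ᶜ := measureReal_nonneg
    have hη : (0 : ℝ) ≤ 2 * δ := by linarith
    -- the three pieces
    have hone := stub_oneFinger_of_spreadSwitch stub_spreadSwitch n w A o t (2 * δ) ho hη hbud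
    have hfew := hFF n w A o t (2 * δ) ho hη hbud
    have hmany := hMF n w A o t (2 * δ) ho hη
      (fun a ha a' ha' => by have := hH2 a ha a' ha'; linarith) hbud h2t
    -- cover
    have hcov :
        {ω | 1 ≤ (A.filter fun a => ω ∈ openConn o a).card ∧
              ((A.filter fun a => ω ∈ openConn o a).card : ℝ) < t} ⊆
          ({ω | 1 ≤ (A.filter fun a => ω ∈ openConn o a).card ∧
               ((A.filter fun a => ω ∈ openConn o a).card : ℝ) < t ∧
               (A.filter fun a => ω ∈ openConnIn ((↑A : Set (Fin n))ᶜ ∪ {o, a}) o a).card ≤ 1} ∪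
           {ω | 1 ≤ (A.filter fun a => ω ∈ openConn o a).card ∧
               ((A.filter fun a => ω ∈ openConn o a).card : ℝ) < t ∧
               2 ≤ (A.filter fun a => ω ∈ openConnIn ((↑A : Set (Fin n))ᶜ ∪ {o, a}) o a).card ∧
               (A.filter fun a => ω ∈ openConnIn ((↑A : Set (Fin n))ᶜ ∪ {o, a}) o a).card ≤ d₀}) ∪
          {ω | 1 ≤ (A.filter fun a => ω ∈ openConn o a).card ∧
               ((A.filter fun a => ω ∈ openConn o a).card : ℝ) < t ∧
               d₀ < (A.filter fun a => ω ∈ openConnIn ((↑A : Set (Fin n))ᶜ ∪ {o, a}) o a).card} := by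
      intro ω hω
      rcases le_or_gt ((A.filter fun a => ω ∈ openConnIn ((↑A : Set (Fin n))ᶜ ∪ {o, a}) o a).card) 1
        with h1 | h1
      · exact Or.inl (Or.inl ⟨hω.1, hω.2, h1⟩)
      · rcases le_or_gt ((A.filter fun a => ω ∈ openConnIn ((↑A : Set (Fin n))ᶜ ∪ {o, a}) o a).card) d₀
          with h2 | h2
        · exact Or.inl (Or.inr ⟨hω.1, hω.2, h1, h2⟩)
        · exact Or.inr ⟨hω.1, hω.2, h2⟩
    -- monotonicity of the error terms in δ
    have hbase : 2 * δ + μ.real (⋃ a ∈ A, openConn o a)ᶜ ≤ 3 * δ := by linarith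
    have hbase0 : 0 ≤ 2 * δ + μ.real (⋃ a ∈ A, openConn o a)ᶜ := by linarith
    have hsq : Real.sqrt (μ.real (⋃ a ∈ A, openConn o a)ᶜ) ≤ Real.sqrt δ :=
      Real.sqrt_le_sqrt hδA.le
    have hp1 : C₁ * (2 * δ + μ.real (⋃ a ∈ A, openConn o a)ᶜ) ^ κ₁ ≤ C₁ * (3 * δ) ^ κ₁ :=
      mul_le_mul_of_nonneg_left (Real.rpow_le_rpow hbase0 hbase hκ₁.le) hC₁.le
    have hp2 : C₂ * (2 * δ + μ.real (⋃ a ∈ A, openConn o a)ᶜ) ^ κ₂ ≤ C₂ * (3 * δ) ^ κ₂ :=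
      mul_le_mul_of_nonneg_left (Real.rpow_le_rpow hbase0 hbase hκ₂.le) hC₂.le
    calc μ.real {ω | 1 ≤ (A.filter fun a => ω ∈ openConn o a).card ∧
              ((A.filter fun a => ω ∈ openConn o a).card : ℝ) < t}
        ≤ μ.real (({ω | 1 ≤ (A.filter fun a => ω ∈ openConn o a).card ∧
               ((A.filter fun a => ω ∈ openConn o a).card : ℝ) < t ∧
               (A.filter fun a => ω ∈ openConnIn ((↑A : Set (Fin n))ᶜ ∪ {o, a}) o a).card ≤ 1} ∪
           {ω | 1 ≤ (A.filter fun a => ω ∈ openConn o a).card ∧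
               ((A.filter fun a => ω ∈ openConn o a).card : ℝ) < t ∧
               2 ≤ (A.filter fun a => ω ∈ openConnIn ((↑A : Set (Fin n))ᶜ ∪ {o, a}) o a).card ∧
               (A.filter fun a => ω ∈ openConnIn ((↑A : Set (Fin n))ᶜ ∪ {o, a}) o a).card ≤ d₀}) ∪
          {ω | 1 ≤ (A.filter fun a => ω ∈ openConn o a).card ∧
               ((A.filter fun a => ω ∈ openConn o a).card : ℝ) < t ∧
               d₀ < (A.filter fun a => ω ∈ openConnIn ((↑A : Set (Fin n))ᶜ ∪ {o, a}) o a).card}) :=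
          measureReal_mono hcov
      _ ≤ (2 * δ + 2 * Real.sqrt (μ.real (⋃ a ∈ A, openConn o a)ᶜ)) +
            C₁ * (2 * δ + μ.real (⋃ a ∈ A, openConn o a)ᶜ) ^ κ₁ +
            C₂ * (2 * δ + μ.real (⋃ a ∈ A, openConn o a)ᶜ) ^ κ₂ := by
          refine (measureReal_union_le _ _).trans (add_le_add ((measureReal_union_le _ _).trans
            (add_le_add hone hfew)) hmany)
      _ ≤ 2 * δ + 2 * Real.sqrt δ + C₁ * (3 * δ) ^ κ₁ + C₂ * (3 * δ) ^ κ₂ := by linarith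
      _ < ε := hsum

end Summit.CriticalPhenomena.PercolationContinuityZ3.Cruxes.NoHeavyLowerTail.AfreeClusterPioneers
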